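import Literature.AlgebraicGeometry.Motives.HodgeThetaAnnihilatorRankOneCentreTimesQSimpleTorus
import HarnessLib

/-!
# Rational tensors on `V₁ ⊕ V₂` killed by `Θ` are killed by `Θ₁ ⊕ 0` when the central part of `Θ₁` and the torus part `Θ₂` are TRACE-NON-ALIGNED over `ℚ` (Moonen–Zarhin 1999 §3 (3.1) / Lemma (3.6): `Hg(X₁ × X₂) = Hg(X₁) × Hg(X₂)` for `X₂` of CM type unless the centre of `Hg(X₁)` and `Hg(X₂)` share a torus through the joint Hodge cocharacter — the Lie step for a centre of ARBITRARY rank, e.g. `X₁` simple of type IV with quartic CM centre and `X₂` a simple CM surface)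

Family `hodge`, layer `Literature/AlgebraicGeometry/Motives` (abstract polarizable `ℚ`-Hodge structures; no geometry).
Research context: cell `pub-hodgeav-hg6` (LADDER-HodgeAV PERC-SHAPE row 2 «base of HC ladder», req-37 (A) Q2b, TABLE X
row 25 `g6.S_ErxY4_E.D4.other ∕ .samefield`; HONEST FRAMING: nothing here proves HC, `HC_AV` or `HC_CM`; not a corollary;
plan of record `run/shared/lean/pub/pub-hodgeav-hg6/jobs/ROW25-eng2g7/MEMO.md` §4, brick R25-1). UNCONDITIONAL linear
algebra / Hodge theory; theorems only (no definition, no named fact, D-0026; nothing admitted); no step towards a summit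
statement. It is the sibling of `HodgeThetaAnnihilatorRankOneCentreTimesQSimpleTorus` (programme R28b: the centre of
`Hg(X₁)` has rank ONE, so a rank-two `ℚ`-simple torus cannot interact) for a centre of HIGHER rank, where interaction CAN
occur (TABLE X rows 23 ∕ 24: the K3 partners) and a genuine non-alignment hypothesis is needed.

PRINTED RESULTS, Lie-algebra form. B. Moonen, Yu. Zarhin, *Hodge classes on abelian varieties of low dimension*, Math.
Ann. 315 (1999) 711–733 [held: `paper:arxiv-math_9901113`]:
* §3 (3.1) (chunk p0006): «Let `X_1` and `X_2` be complex abelian varieties. Write `X = X_1 × X_2`. Then `Hg(X)` is an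
  algebraic subgroup of `Hg(X_1) × Hg(X_2)` […] `hg(X) = 𝔤₁ ⊕ 𝔤₂ ⊕ 𝔤₃` […] `𝔤₃` is the graph of an isomorphism […] We may
  have that `Hg(X_1 × X_2) ≠ Hg(X_1) × Hg(X_2)`»;
* §3 Lemma (3.6) (chunk p0007): «Assume that the Hodge group `Hg(X₂)` is a `ℚ`-simple algebraic torus. (In particular
  `X₂` is of CM-type.) Write `X = X₁ × X₂`. If `Hg(X) ≠ Hg(X₁) × Hg(X₂)` then the center of `Hg(X₁)` contains an
  algebraic torus which is `ℚ`-isogenous to `Hg(X₂)`»;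
* §5 Case 2 ∕ (5.10) (chunk p0010): the products `Y₁ × Y₂` with `Y₁` a simple CM surface.
P. Deligne, LNM 900 (1982), I §3 Prop. 3.4 (rational structures and base change), Prop. 3.6 (`Hg` reductive: the tree's
`ThetaSubalgebra.center_sup_derived_eq`). D. Lombardo, Ann. Inst. Fourier 66 (2016), Lemma 3.4 (the Goursat step).

THIS FILE (the Lie step for an interaction test between the CENTRE of `Hg(X₁)` and a torus `Hg(X₂)`, in the tree's word
model). SETTING: a `ℚ`-space `U = ι₁V₁ ⊕ ι₂V₂`, effective weight-one Hodge structures `H_U, H₁, H₂` (`ι_i` map pieces into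
pieces), polarizations `ψ₁, ψ₂`; on `V₁` two auxiliary rational subspaces of operators `𝔷₁` («`E⁻ = Lie Z(Hg X₁)`») and
`𝔷₁'` («`E`», inside `End_Hdg(V₁)`) with
  (Z1)  every `ψ₁`-skew central Hodge endomorphism of `V₁` lies in `𝔷₁` (no rank condition);
  (ND₁) every rational linear functional on `End_ℚ(V₁)` agrees on `𝔷₁` with `x ↦ Tr(a x)` for some `a ∈ 𝔷₁'`
        (for `E` a CM field acting on `V₁`: the trace form `Tr_{E∕ℚ}(x ȳ)` is definite);
on `V₂` a family `(f_i)` of Hodge endomorphisms, a COMMUTATIVE `ℚ`-subspace `𝔲 ⊆ End_ℚ(V₂)` (for a simple CM surface: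
`f_e = e^*`, `e ∈ F = End⁰(S)` a quartic CM field, `𝔲 = F⁻ = Lie U_F`) and an auxiliary subspace `𝔲'` («`F`») with
  (COMM) every `ψ₂,ℂ`-skew complex operator commuting with the `f_{i,ℂ}` lies in `𝔲_ℂ`;
  (ND₂) every rational linear functional on `End_ℚ(V₂)` agrees on `𝔲` with `y ↦ Tr(b y)` for some `b ∈ 𝔲'`;
and the NON-ALIGNMENT hypothesis
  (NA)   for `a ∈ 𝔷₁'`, `b ∈ 𝔲'`: `Tr(a_ℂ Θ₁) + Tr(b_ℂ Θ₂) = 0` ⟹ `Tr(a ·) = 0` on `𝔷₁` and `Tr(b ·) = 0` on `𝔲`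
(for `X₁ = Y` simple of type IV with quartic CM centre `E` of signature `{(2,0),(1,1)}` and `X₂ = S` a simple CM surface
of type `(F, Φ)` this reads «`4τ₀(a⁻) + 2 tr_Φ(b⁻) = 0 ⟹ a⁻ = 0 = b⁻`», which holds exactly when `τ₀(E) = ℚ(μ₂)` and the
reflex field `K*_Φ ⊂ ℂ` share no non-zero purely imaginary element — the NON-ALIGNED members of TABLE X row 25; it
fails for the K3 partners of rows 23 ∕ 24).
MAIN RESULT (`wordDerAt_incl_theta_proj_eq_zero_of_centre_times_torus_of_traceNonAligned`): every rational coefficient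
tensor `q` on `U` killed slice by slice by the matrix of `Θ_U` is killed by the matrix of the partial Hodge operator
`ι₁ ∘ Θ₁ ∘ π₁` («`Hg(X₁ × X₂) = Hg(X₁) × Hg(X₂)`» read on tensor invariants) — the conclusion of the tree's
`wordDerAt_incl_theta_proj_eq_zero_of_thetaTrace_times_abelian`, so the typed-Künneth pipeline of programme R5 applies
verbatim. Neither (NOSQ) nor (QS) of R28b is needed.

PROOF (R28b verbatim up to the corner algebra, then NEW). `𝔞 = annLie(q)` (killing `q`; commuting with `ι₁aπ₁`
(`a ∈ End_Hdg V₁`), `ι₂f_iπ₂` and the two projectors; skew for `ψ₁(π₁·,π₁·) + ψ₂(π₂·,π₂·)`), so `Θ_U ∈ 𝔞_ℂ`. The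
`V₂`-corners of `𝔞` are `ψ₂`-skew and commute with the `f_i`, hence (COMM + descent) lie in `𝔲` and COMMUTE; Goursat:
`ι₁𝔡(𝔤)_ℂπ₁ ⊆ 𝔞_ℂ` for the corner algebra `𝔤 = c₁(𝔞) ∋_ℂ Θ₁`; Deligne reductivity `𝔤 = 𝔷(𝔤) ⊕ 𝔡(𝔤)` and (Z1) give
`Θ₁ = z + s`, `z ∈ (𝔷₁)_ℂ`, `s ∈ 𝔡(𝔤)_ℂ`, `ι₁sπ₁ ∈ 𝔞_ℂ`, and `z` is CANONICAL up to traces against `𝔷₁'`: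
`Tr(a_ℂ s) = 0` for `a ∈ 𝔷₁' ⊆ End_Hdg(V₁)` (which commutes with `𝔤`; `Tr(a[Y,Y']) = 0`). NEW ENDGAME: let
`W = ι₁𝔷₁π₁ ⊕ ι₂𝔲π₂` and `T = ι₁zπ₁ + ι₂Θ₂π₂ = Θ_U − ι₁sπ₁ ∈ 𝔞_ℂ ∩ W_ℂ = (𝔞 ∩ W)_ℂ` (BASE CHANGE COMMUTES WITH
INTERSECTIONS, `spanC_inf`). If `W ⊄ 𝔞`, a rational functional `f` kills `𝔞 ∩ W` but not some `w₀ ∈ W`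
(`Submodule.exists_dual_map_eq_bot_of_notMem`); its complexification `g` (`exists_functionalC`, through
`κ : ℂ ⊗ End_ℚ(U) ≅ End_ℂ(U_ℂ)`) kills `T`; by (ND₁)(ND₂) `f(ι₁xπ₁) = Tr(ax)` on `𝔷₁` and `f(ι₂yπ₂) = Tr(by)` on `𝔲`, so
`0 = g(T) = Tr(a_ℂ z) + Tr(b_ℂ Θ₂) = Tr(a_ℂ Θ₁) + Tr(b_ℂ Θ₂)`; (NA) gives `f(W) = 0`, a contradiction. Hence `W ⊆ 𝔞`,
`ι₂Θ₂π₂ ∈ 𝔞_ℂ` and `ι₁Θ₁π₁ = Θ_U − ι₂Θ₂π₂ ∈ 𝔞_ℂ`. (Moonen–Zarhin: `𝔞 ∩ (Lie Z(Hg X₁) ⊕ Lie Hg X₂)` is the Lie shadow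
of the torus part of `hg(X)`; it is all of `Lie Z × Lie Hg(X₂)` exactly when no rational relation ties the two components
of the joint Hodge cocharacter, i.e. when the graph `𝔤₃` of (3.1) is trivial on the centre.)

CONTENTS. §1 complexification of rational functionals (`exists_functionalC`); traces of commutators against a
commuting operator (`trace_mul_eq_zero_of_mem_span_commutators`); §2 the product Lie step.

## References

* [MoonenZarhin1999LowDim] B. Moonen, Yu. Zarhin, Math. Ann. 315 (1999), §3 (3.1), Lemma (3.6), §5 Case 2 (5.10)
  (held `paper:arxiv-math_9901113` pp. 6–7, 10). [cite: MoonenZarhin1999LowDim, §3 (3.1) and Lemma (3.6)]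
* [Deligne1982HodgeCycles] P. Deligne, LNM 900 (1982), I §3 Prop. 3.4 (rational structures and base change),
  Prop. 3.6 (reductivity). [cite: Deligne1982HodgeCycles, I §3 Prop. 3.6]
* [Lombardo2016] D. Lombardo, Ann. Inst. Fourier 66 (2016), Lemma 3.4 (p. 1229) (the Goursat step). [cite: Lombardo2016, Lemma 3.4 (p. 1229)]
-/

noncomputable section

open scoped TensorProduct
open CategoryTheory Module

namespace Literature.AlgebraicGeometry.Motives

namespace HodgeStructure

open Literature.RepresentationTheory.GeneralLinear

universe u

/-! ### §1 Complexification of rational functionals; traces of commutators -/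

section Functionals

variable {U V : Type u} [AddCommGroup U] [Module ℚ U] [AddCommGroup V] [Module ℚ V]

/-- **Complexification of a rational linear functional on operators**: for every `ℚ`-linear `f : End_ℚ(V) → ℚ` there
is a `ℂ`-linear `g : End_ℂ(V_ℂ) → ℂ` with `g(X_ℂ) = f(X)` — `g = (f ⊗ ℂ) ∘ κ⁻¹` through the comparison
`κ : ℂ ⊗ End_ℚ(V) ≅ End_ℂ(V_ℂ)` (`homBaseChange`, bijective for finite-dimensional `V`). Deligne I §3: rational structures
and base change. [cite: Deligne1982HodgeCycles, I §3 (proof of Prop. 3.4)] -/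
theorem exists_functionalC [Module.Finite ℚ V] (f : Module.End ℚ V →ₗ[ℚ] ℚ) :
    ∃ g : Module.End ℂ (ℂ ⊗[ℚ] V) →ₗ[ℂ] ℂ, ∀ X : Module.End ℚ V, g (X.baseChange ℂ) = (f X : ℂ) := by
  set κ := LinearEquiv.ofBijective (homBaseChange V V) (homBaseChange_bijective (V := V) (W := V)) with hκ
  have hκapply : ∀ X : Module.End ℚ V, κ ((1 : ℂ) ⊗ₜ[ℚ] X) = X.baseChange ℂ := fun X => by
    rw [hκ, LinearEquiv.ofBijective_apply, homBaseChange_tmul, one_smul]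
  refine ⟨(TensorProduct.AlgebraTensorModule.rid ℚ ℂ ℂ).toLinearMap ∘ₗ f.baseChange ℂ ∘ₗ κ.symm.toLinearMap,
    fun X => ?_⟩
  simp only [LinearMap.comp_apply, LinearEquiv.coe_toLinearMap]
  rw [← hκapply, LinearEquiv.symm_apply_apply, LinearMap.baseChange_tmul, TensorProduct.AlgebraTensorModule.rid_tmul,
    Rat.smul_one_eq_cast]

/-- A `ℂ`-linear functional vanishing on the `X_ℂ`, `X ∈ 𝔞`, vanishes on `𝔞_ℂ`. [cite: Deligne1982HodgeCycles, I §3 (proof of Prop. 3.4)] -/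
theorem functionalC_eq_zero_of_mem_spanC {𝔞 : Submodule ℚ (Module.End ℚ V)} (g : Module.End ℂ (ℂ ⊗[ℚ] V) →ₗ[ℂ] ℂ)
    (hg : ∀ X ∈ 𝔞, g (X.baseChange ℂ) = 0) {T : Module.End ℂ (ℂ ⊗[ℚ] V)} (hT : T ∈ spanC 𝔞) : g T = 0 := by
  induction hT using Submodule.span_induction with
  | mem Z hZ =>
    obtain ⟨X, hX, rfl⟩ := hZ
    exact hg X hX
  | zero => rw [map_zero]
  | add Z Z' _ _ hZ hZ' => rw [map_add, hZ, hZ', add_zero]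
  | smul c Z _ hZ => rw [map_smul, hZ, smul_zero]

/-- **Traces of commutators against a commuting operator vanish**: if `a_ℂ` commutes with every `X_ℂ`, `X ∈ 𝔤`, then
`Tr(a_ℂ Z) = 0` for every `Z` in the complex span of the brackets `[X_ℂ, X'_ℂ]`, `X, X' ∈ 𝔤`
(`Tr(a X X') = Tr(X' a X) = Tr(a X' X)`). For `a` in the commutative centre `E = End_Hdg(V₁)` and `𝔤 ⊆ 𝔲_E` this is
«the derived algebra is trace-orthogonal to the centre». [cite: MoonenZarhin1999LowDim, §3 (3.1)] [cite: Deligne1982HodgeCycles, I §3 Prop. 3.6] -/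
theorem trace_mul_eq_zero_of_mem_span_commutators [Module.Finite ℚ V] {𝔤 : Submodule ℚ (Module.End ℚ V)}
    {a : Module.End ℚ V} (ha : ∀ X ∈ 𝔤, X * a = a * X) {Z : Module.End ℂ (ℂ ⊗[ℚ] V)}
    (hZ : Z ∈ Submodule.span ℂ {B | ∃ X ∈ 𝔤, ∃ X' ∈ 𝔤,
      X.baseChange ℂ * X'.baseChange ℂ - X'.baseChange ℂ * X.baseChange ℂ = B}) :
    LinearMap.trace ℂ _ (a.baseChange ℂ * Z) = 0 := by
  induction hZ using Submodule.span_induction with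
  | mem B hB =>
    obtain ⟨X, hX, X', hX', rfl⟩ := hB
    have haX : a.baseChange ℂ * X.baseChange ℂ = X.baseChange ℂ * a.baseChange ℂ := by
      rw [← LinearMap.baseChange_mul, ← ha X hX, LinearMap.baseChange_mul]
    rw [mul_sub, map_sub, ← mul_assoc, ← mul_assoc, haX, mul_assoc, LinearMap.trace_mul_comm ℂ (X.baseChange ℂ),
      mul_assoc, sub_self]
  | zero => rw [mul_zero, map_zero]
  | add B B' _ _ hB hB' => rw [mul_add, map_add, hB, hB', add_zero]
  | smul c B _ hB => rw [mul_smul_comm, map_smul, hB, smul_zero]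

omit [AddCommGroup U] [Module ℚ U] in
/-- Complexification of a sum of bilinear forms, evaluated (a copy of the private lemma of
`HodgeThetaAnnihilatorRankOneCentreTimesQSimpleTorus`). [folklore] -/
private theorem baseChange_add_apply₄ (B B' : LinearMap.BilinForm ℚ V) (x y : ℂ ⊗[ℚ] V) :
    LinearMap.BilinForm.baseChange ℂ (B + B') x y =
      LinearMap.BilinForm.baseChange ℂ B x y + LinearMap.BilinForm.baseChange ℂ B' x y := by
  induction x using TensorProduct.induction_on with
  | zero => simp
  | tmul c v =>
    induction y using TensorProduct.induction_on with
    | zero => simp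
    | tmul d w =>
      simp only [LinearMap.BilinForm.baseChange_tmul, LinearMap.add_apply, add_smul]
    | add y y' hy hy' => rw [map_add, map_add, map_add, hy, hy']; abel
  | add x x' hx hx' =>
    rw [map_add, LinearMap.add_apply, map_add, map_add, LinearMap.add_apply, LinearMap.add_apply, hx, hx']
    abel

end Functionals

/-! ### §2 The product Lie step: centre of `Hg(X₁)` against a torus `Hg(X₂)`, under trace non-alignment -/

section Main

variable {U V₁ V₂ : Type u} [AddCommGroup U] [Module ℚ U] [AddCommGroup V₁] [Module ℚ V₁]
  [AddCommGroup V₂] [Module ℚ V₂] [Module.Finite ℚ U] [Module.Finite ℚ V₁] [Module.Finite ℚ V₂]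
  [HodgeTensorFacts.{u, u}] {n : ℤ}
variable {M d m : ℕ}

/-- **Theorem (Moonen–Zarhin 1999 §3 (3.1) / Lemma (3.6) for a torus `Hg(X₂)` against the CENTRE of `Hg(X₁)`, Lie step,
word model, under TRACE NON-ALIGNMENT).** Let `U = ι₁V₁ ⊕ ι₂V₂` be a presentation compatible with effective weight-one Hodge
structures `H_U, H₁, H₂`, polarizations `ψ₁, ψ₂`; rational subspaces `𝔷₁, 𝔷₁' ⊆ End_ℚ(V₁)` with (Z1) every `ψ₁`-skew central
Hodge endomorphism of `V₁` in `𝔷₁`, `𝔷₁' ⊆ End_Hdg(V₁)`, and (ND₁) every rational functional on `End_ℚ(V₁)` represented on `𝔷₁`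
by `Tr(a ·)`, `a ∈ 𝔷₁'`; on `V₂` a family `(f_i)` of Hodge endomorphisms, a commutative `ℚ`-subspace `𝔲` with (COMM) every
`ψ₂,ℂ`-skew complex operator commuting with the `f_{i,ℂ}` in `𝔲_ℂ` (so `𝔲 ⊇` the skew commutant; no skewness of `𝔲` itself is
used), and `𝔲' ⊆ End_ℚ(V₂)` with (ND₂) every rational functional on `End_ℚ(V₂)` represented on `𝔲` by `Tr(b ·)`, `b ∈ 𝔲'`; and (NA): for `a ∈ 𝔷₁'`,
`b ∈ 𝔲'`, `Tr(a_ℂ Θ₁) + Tr(b_ℂ Θ₂) = 0` forces `Tr(a ·)|_{𝔷₁} = 0` and `Tr(b ·)|_{𝔲} = 0`. Then if the rational tensor `q` is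
killed slice by slice by the matrix of `Θ_U`, it is killed by the matrix of the partial Hodge operator `ι₁ ∘ Θ₁ ∘ π₁` —
«`Hg(X₁ × X₂) = Hg(X₁) × Hg(X₂)`» read on tensor invariants («`𝔤₃` is the graph of an isomorphism» — here trivial on the
centre: no rational relation ties the central part of `Θ₁` to `Θ₂`). [cite: MoonenZarhin1999LowDim, §3 (3.1) and Lemma (3.6)]
[cite: Deligne1982HodgeCycles, I §3 Prop. 3.4 and Prop. 3.6] [cite: Lombardo2016, Lemma 3.4 (p. 1229)] -/
theorem wordDerAt_incl_theta_proj_eq_zero_of_centre_times_torus_of_traceNonAligned (hn : n = 1)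
    (HU : HodgeStructure U n) (H₁ : HodgeStructure V₁ n) (H₂ : HodgeStructure V₂ n) (heff₁ : H₁.IsEffective)
    {ι₁ : V₁ →ₗ[ℚ] U} {π₁ : U →ₗ[ℚ] V₁} {ι₂ : V₂ →ₗ[ℚ] U} {π₂ : U →ₗ[ℚ] V₂}
    (hπι₁ : π₁ ∘ₗ ι₁ = LinearMap.id) (hπι₂ : π₂ ∘ₗ ι₂ = LinearMap.id) (hπ₁ι₂ : π₁ ∘ₗ ι₂ = 0)
    (hπ₂ι₁ : π₂ ∘ₗ ι₁ = 0) (hsum : ι₁ ∘ₗ π₁ + ι₂ ∘ₗ π₂ = LinearMap.id)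
    (hι₁F : ∀ p, ∀ x ∈ H₁.piece p (n - p), ι₁.baseChange ℂ x ∈ HU.piece p (n - p))
    (hι₂F : ∀ p, ∀ x ∈ H₂.piece p (n - p), ι₂.baseChange ℂ x ∈ HU.piece p (n - p))
    (ψ₁ : H₁.Polarization) (ψ₂ : H₂.Polarization)
    (𝔷₁ 𝔷₁' : Submodule ℚ (Module.End ℚ V₁))
    (hZ₁ : ∀ a ∈ H₁.endAlg, (∀ b ∈ H₁.endAlg, a * b = b * a) →
      (∀ v w, ψ₁.form (a v) w + ψ₁.form v (a w) = 0) → a ∈ 𝔷₁)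
    (h𝔷₁'E : ∀ a ∈ 𝔷₁', a ∈ H₁.endAlg)
    (hND₁ : ∀ ℓ : Module.End ℚ V₁ →ₗ[ℚ] ℚ, ∃ a ∈ 𝔷₁', ∀ x ∈ 𝔷₁, ℓ x = LinearMap.trace ℚ V₁ (a * x))
    {ιF : Type*} (fam : ιF → Module.End ℚ V₂) (hfamE : ∀ i, fam i ∈ H₂.endAlg)
    (𝔲 𝔲' : Submodule ℚ (Module.End ℚ V₂)) (h𝔲c : ∀ y ∈ 𝔲, ∀ y' ∈ 𝔲, y * y' = y' * y)
    (hcommC : ∀ Y : Module.End ℂ (ℂ ⊗[ℚ] V₂), (∀ i, Y * (fam i).baseChange ℂ = (fam i).baseChange ℂ * Y) →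
      (∀ x y, ψ₂.form.baseChange ℂ (Y x) y + ψ₂.form.baseChange ℂ x (Y y) = 0) → Y ∈ spanC 𝔲)
    (hND₂ : ∀ ℓ : Module.End ℚ V₂ →ₗ[ℚ] ℚ, ∃ b ∈ 𝔲', ∀ y ∈ 𝔲, ℓ y = LinearMap.trace ℚ V₂ (b * y))
    {ΘU : Module.End ℂ (ℂ ⊗[ℚ] U)} (hΘU : ∀ p, ∀ x ∈ HU.piece p (n - p), ΘU x = ((2 * p - n : ℤ) : ℂ) • x)
    {Θ₁ : Module.End ℂ (ℂ ⊗[ℚ] V₁)} (hΘ₁ : ∀ p, ∀ x ∈ H₁.piece p (n - p), Θ₁ x = ((2 * p - n : ℤ) : ℂ) • x)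
    {Θ₂ : Module.End ℂ (ℂ ⊗[ℚ] V₂)} (hΘ₂ : ∀ p, ∀ x ∈ H₂.piece p (n - p), Θ₂ x = ((2 * p - n : ℤ) : ℂ) • x)
    (hNA : ∀ a ∈ 𝔷₁', ∀ b ∈ 𝔲',
      LinearMap.trace ℂ _ (a.baseChange ℂ * Θ₁) + LinearMap.trace ℂ _ (b.baseChange ℂ * Θ₂) = 0 →
        (∀ x ∈ 𝔷₁, LinearMap.trace ℚ V₁ (a * x) = 0) ∧ (∀ y ∈ 𝔲, LinearMap.trace ℚ V₂ (b * y) = 0))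
    (eQ : Module.Basis (Fin M) ℚ U) (q : (Fin d → Fin m × Fin M) → ℚ)
    (hΘq : ∀ u : Fin d → Fin m, wordDerAt ℂ (fun _ : Fin d =>
      LinearMap.toMatrix (Algebra.TensorProduct.basis ℂ eQ) (Algebra.TensorProduct.basis ℂ eQ) ΘU)
      (wordSlice (fun w => algebraMap ℚ ℂ (q w)) u) = 0)
    (u : Fin d → Fin m) :
    wordDerAt ℂ (fun _ : Fin d =>
      LinearMap.toMatrix (Algebra.TensorProduct.basis ℂ eQ) (Algebra.TensorProduct.basis ℂ eQ)
        (ι₁.baseChange ℂ ∘ₗ Θ₁ ∘ₗ π₁.baseChange ℂ))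
      (wordSlice (fun w => algebraMap ℚ ℂ (q w)) u) = 0 := by
  classical
  have hΘ₁C : Θ₁ ∈ H₁.hodgeLieC := H₁.mem_hodgeLieC_of_forall_piece hΘ₁
  have hΘ₂C : Θ₂ ∈ H₂.hodgeLieC := H₂.mem_hodgeLieC_of_forall_piece hΘ₂
  have hsum' : ι₂ ∘ₗ π₂ + ι₁ ∘ₗ π₁ = LinearMap.id := by rw [add_comm]; exact hsum
  -- pointwise slot identities
  have e11 : ∀ v, π₁ (ι₁ v) = v := fun v => by
    rw [← LinearMap.comp_apply (f := π₁), hπι₁, LinearMap.id_apply]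
  have e22 : ∀ w, π₂ (ι₂ w) = w := fun w => by
    rw [← LinearMap.comp_apply (f := π₂), hπι₂, LinearMap.id_apply]
  have e12 : ∀ w, π₁ (ι₂ w) = 0 := fun w => by
    rw [← LinearMap.comp_apply (f := π₁), hπ₁ι₂, LinearMap.zero_apply]
  have e21 : ∀ v, π₂ (ι₁ v) = 0 := fun v => by
    rw [← LinearMap.comp_apply (f := π₂), hπ₂ι₁, LinearMap.zero_apply]
  -- `Θ` through the presentation
  have hΘι₁ := theta_incl_eq HU H₁ hι₁F hΘU hΘ₁
  have hΘι₂ := theta_incl_eq HU H₂ hι₂F hΘU hΘ₂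
  have hΘπ₁ := proj_theta_eq HU H₁ H₂ hπι₁ hπ₁ι₂ hsum hι₁F hι₂F hΘU hΘ₁ hΘ₂
  have hΘπ₂ := proj_theta_eq HU H₂ H₁ hπι₂ hπ₂ι₁ hsum' hι₂F hι₁F hΘU hΘ₂ hΘ₁
  have hΘUdec : ΘU = ι₁.baseChange ℂ ∘ₗ Θ₁ ∘ₗ π₁.baseChange ℂ + ι₂.baseChange ℂ ∘ₗ Θ₂ ∘ₗ π₂.baseChange ℂ := by
    apply LinearMap.ext
    intro y
    conv_lhs => rw [← incl_proj_add_baseChange hsum y]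
    rw [map_add, hΘι₁, hΘι₂]
    rfl
  -- the commuting family: `ι₁ a π₁` (`a ∈ End_Hdg V₁`), `ι₂ f_i π₂` (the `V₂`-family), the two projectors
  set aF : (H₁.endAlg ⊕ ιF) ⊕ (Unit ⊕ Unit) → Module.End ℚ U :=
    Sum.elim (Sum.elim (fun a => ι₁ ∘ₗ (a : Module.End ℚ V₁) ∘ₗ π₁) (fun i => ι₂ ∘ₗ fam i ∘ₗ π₂))
      (Sum.elim (fun _ => ι₁ ∘ₗ π₁) (fun _ => ι₂ ∘ₗ π₂)) with haF
  set φ : LinearMap.BilinForm ℚ U := ψ₁.form.compl₁₂ π₁ π₁ + ψ₂.form.compl₁₂ π₂ π₂ with hφ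
  have hφC : ∀ x y, φ.baseChange ℂ x y = ψ₁.form.baseChange ℂ (π₁.baseChange ℂ x) (π₁.baseChange ℂ y) +
      ψ₂.form.baseChange ℂ (π₂.baseChange ℂ x) (π₂.baseChange ℂ y) := fun x y => by
    rw [hφ, baseChange_add_apply₄, baseChange_compl₁₂_apply, baseChange_compl₁₂_apply]
  have hφapply : ∀ x y, φ x y = ψ₁.form (π₁ x) (π₁ y) + ψ₂.form (π₂ x) (π₂ y) := fun x y => by
    rw [hφ, LinearMap.add_apply, LinearMap.add_apply, LinearMap.compl₁₂_apply, LinearMap.compl₁₂_apply]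
  set 𝔞 : Submodule ℚ (Module.End ℚ U) := annLie φ eQ aF q with h𝔞
  -- `Θ_U ∈ 𝔞_ℂ`
  have hΘ𝔞 : ΘU ∈ spanC 𝔞 := by
    refine mem_spanC_annLie φ eQ aF q hΘq (fun i => ?_) (fun x y => ?_)
    · apply LinearMap.ext
      intro y
      rcases i with (a | i) | (_ | _)
      · change ΘU ((ι₁ ∘ₗ (a : Module.End ℚ V₁) ∘ₗ π₁).baseChange ℂ y) =
          (ι₁ ∘ₗ (a : Module.End ℚ V₁) ∘ₗ π₁).baseChange ℂ (ΘU y)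
        simp only [LinearMap.baseChange_comp, LinearMap.comp_apply]
        rw [hΘι₁, ← Module.End.mul_apply (f := Θ₁), commute_baseChange_of_mem_hodgeLieC H₁ hΘ₁C a,
          Module.End.mul_apply, hΘπ₁]
      · change ΘU ((ι₂ ∘ₗ fam i ∘ₗ π₂).baseChange ℂ y) = (ι₂ ∘ₗ fam i ∘ₗ π₂).baseChange ℂ (ΘU y)
        simp only [LinearMap.baseChange_comp, LinearMap.comp_apply]
        rw [hΘι₂, ← Module.End.mul_apply (f := Θ₂), commute_baseChange_of_mem_hodgeLieC H₂ hΘ₂C ⟨fam i, hfamE i⟩,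
          Module.End.mul_apply, hΘπ₂]
      · change ΘU ((ι₁ ∘ₗ π₁).baseChange ℂ y) = (ι₁ ∘ₗ π₁).baseChange ℂ (ΘU y)
        simp only [LinearMap.baseChange_comp, LinearMap.comp_apply]
        rw [hΘι₁, hΘπ₁]
      · change ΘU ((ι₂ ∘ₗ π₂).baseChange ℂ y) = (ι₂ ∘ₗ π₂).baseChange ℂ (ΘU y)
        simp only [LinearMap.baseChange_comp, LinearMap.comp_apply]
        rw [hΘι₂, hΘπ₂]
    · rw [hφC, hφC, hΘπ₁, hΘπ₁, hΘπ₂, hΘπ₂, formBaseChange_skew_of_mem_hodgeLieC ψ₁ hΘ₁C,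
        formBaseChange_skew_of_mem_hodgeLieC ψ₂ hΘ₂C]
      ring
  -- what membership in `𝔞` gives
  have hmem : ∀ X ∈ 𝔞, (∀ i, X * aF i = aF i * X) ∧ ∀ v w, φ (X v) w + φ v (X w) = 0 :=
    fun X hX => ((mem_annLie_iff φ eQ aF q X).1 hX).2
  have hP₁ : ∀ X ∈ 𝔞, X * (ι₁ ∘ₗ π₁) = (ι₁ ∘ₗ π₁) * X := fun X hX => (hmem X hX).1 (Sum.inr (Sum.inl ()))
  have hP₂ : ∀ X ∈ 𝔞, X * (ι₂ ∘ₗ π₂) = (ι₂ ∘ₗ π₂) * X := fun X hX => (hmem X hX).1 (Sum.inr (Sum.inr ()))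
  have hTa : ∀ X ∈ 𝔞, ∀ a : H₁.endAlg, X * (ι₁ ∘ₗ (a : Module.End ℚ V₁) ∘ₗ π₁) =
      (ι₁ ∘ₗ (a : Module.End ℚ V₁) ∘ₗ π₁) * X := fun X hX a => (hmem X hX).1 (Sum.inl (Sum.inl a))
  have hTb : ∀ X ∈ 𝔞, ∀ i, X * (ι₂ ∘ₗ fam i ∘ₗ π₂) = (ι₂ ∘ₗ fam i ∘ₗ π₂) * X :=
    fun X hX i => (hmem X hX).1 (Sum.inl (Sum.inr i))
  -- the corners commute with `End_Hdg(V₁)` resp. the `V₂`-family, and are skew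
  have hc₁comm : ∀ X ∈ 𝔞, ∀ a : H₁.endAlg, (π₁ ∘ₗ X ∘ₗ ι₁) * (a : Module.End ℚ V₁) =
      (a : Module.End ℚ V₁) * (π₁ ∘ₗ X ∘ₗ ι₁) := by
    intro X hX a
    apply LinearMap.ext
    intro v
    have h := congrArg (fun f : Module.End ℚ U => π₁ (f (ι₁ v))) (hTa X hX a)
    simp only [Module.End.mul_apply, LinearMap.comp_apply, e11] at h
    simp only [Module.End.mul_apply, LinearMap.comp_apply]
    exact h
  have hc₂comm : ∀ X ∈ 𝔞, ∀ i, (π₂ ∘ₗ X ∘ₗ ι₂) * fam i = fam i * (π₂ ∘ₗ X ∘ₗ ι₂) := by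
    intro X hX i
    apply LinearMap.ext
    intro w
    have h := congrArg (fun g : Module.End ℚ U => π₂ (g (ι₂ w))) (hTb X hX i)
    simp only [Module.End.mul_apply, LinearMap.comp_apply, e22] at h
    simp only [Module.End.mul_apply, LinearMap.comp_apply]
    exact h
  have hc₁skew : ∀ X ∈ 𝔞, ∀ v w, ψ₁.form ((π₁ ∘ₗ X ∘ₗ ι₁) v) w + ψ₁.form v ((π₁ ∘ₗ X ∘ₗ ι₁) w) = 0 := by
    intro X hX v w
    have h := (hmem X hX).2 (ι₁ v) (ι₁ w)
    rw [apply_incl_eq_of_commute_projector hπι₁ (hP₁ X hX) v,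
      apply_incl_eq_of_commute_projector hπι₁ (hP₁ X hX) w, hφapply, hφapply] at h
    simp only [e11, e21, map_zero, add_zero] at h
    simpa only [LinearMap.comp_apply] using h
  have hc₂skew : ∀ X ∈ 𝔞, ∀ v w, ψ₂.form ((π₂ ∘ₗ X ∘ₗ ι₂) v) w + ψ₂.form v ((π₂ ∘ₗ X ∘ₗ ι₂) w) = 0 := by
    intro X hX v w
    have h := (hmem X hX).2 (ι₂ v) (ι₂ w)
    rw [apply_incl_eq_of_commute_projector hπι₂ (hP₂ X hX) v,
      apply_incl_eq_of_commute_projector hπι₂ (hP₂ X hX) w, hφapply, hφapply] at h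
    simp only [e22, e12, map_zero, zero_add] at h
    simpa only [LinearMap.comp_apply] using h
  -- the `V₂`-corners lie in the plane `𝔲` (COMM + descent), hence commute
  have hc₂𝔲 : ∀ X ∈ 𝔞, π₂ ∘ₗ X ∘ₗ ι₂ ∈ 𝔲 := by
    intro X hX
    refine mem_of_baseChange_mem_spanC 𝔲 (hcommC _ (fun i => ?_)
      (ThetaSubalgebra.formBaseChange_add_eq_zero_of_skew ψ₂ (hc₂skew X hX)))
    rw [← LinearMap.baseChange_mul, hc₂comm X hX i, LinearMap.baseChange_mul]
  have hc₂c : ∀ X ∈ 𝔞, ∀ X' ∈ 𝔞,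
      (π₂ ∘ₗ X ∘ₗ ι₂) * (π₂ ∘ₗ X' ∘ₗ ι₂) = (π₂ ∘ₗ X' ∘ₗ ι₂) * (π₂ ∘ₗ X ∘ₗ ι₂) := fun X hX X' hX' =>
    h𝔲c _ (hc₂𝔲 X hX) _ (hc₂𝔲 X' hX')
  -- the Goursat step inside `𝔞`
  have hbr𝔞 : ∀ X ∈ 𝔞, ∀ X' ∈ 𝔞,
      ι₁ ∘ₗ ((π₁ ∘ₗ X ∘ₗ ι₁) * (π₁ ∘ₗ X' ∘ₗ ι₁) - (π₁ ∘ₗ X' ∘ₗ ι₁) * (π₁ ∘ₗ X ∘ₗ ι₁)) ∘ₗ π₁ ∈ 𝔞 := by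
    intro X hX X' hX'
    rw [← bracket_eq_incl_corner_bracket_proj hπι₁ hπι₂ hsum (hP₁ X hX) (hP₂ X hX) (hP₁ X' hX') (hP₂ X' hX')
      (hc₂c X hX X' hX')]
    exact commutator_mem_annLie φ eQ aF q hX hX'
  -- the corner algebra `𝔤 = c₁(𝔞)`
  obtain ⟨cLin, hcLin⟩ : ∃ L : Module.End ℚ U →ₗ[ℚ] Module.End ℚ V₁, ∀ X, L X = π₁ ∘ₗ X ∘ₗ ι₁ :=
    ⟨{ toFun := fun X => π₁ ∘ₗ X ∘ₗ ι₁
       map_add' := fun X X' => by rw [LinearMap.add_comp, LinearMap.comp_add]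
       map_smul' := fun c X => by rw [LinearMap.smul_comp, LinearMap.comp_smul, RingHom.id_apply] },
      fun X => rfl⟩
  set 𝔤 : Submodule ℚ (Module.End ℚ V₁) := 𝔞.map cLin with h𝔤
  have h𝔤mem : ∀ {Y}, Y ∈ 𝔤 ↔ ∃ X ∈ 𝔞, π₁ ∘ₗ X ∘ₗ ι₁ = Y := by
    intro Y
    rw [h𝔤, Submodule.mem_map]
    simp only [hcLin]
  have hbr𝔤 : ∀ Y ∈ 𝔤, ∀ Y' ∈ 𝔤, Y * Y' - Y' * Y ∈ 𝔤 := by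
    intro Y hY Y' hY'
    obtain ⟨X, hX, rfl⟩ := h𝔤mem.1 hY
    obtain ⟨X', hX', rfl⟩ := h𝔤mem.1 hY'
    refine h𝔤mem.2 ⟨_, hbr𝔞 X hX X' hX', ?_⟩
    apply LinearMap.ext
    intro v
    simp only [LinearMap.comp_apply, LinearMap.sub_apply, Module.End.mul_apply, e11]
  have hcomm𝔤 : ∀ Y ∈ 𝔤, ∀ a : H₁.endAlg, Y * (a : Module.End ℚ V₁) = (a : Module.End ℚ V₁) * Y := by
    intro Y hY a
    obtain ⟨X, hX, rfl⟩ := h𝔤mem.1 hY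
    exact hc₁comm X hX a
  have hskew𝔤 : ∀ Y ∈ 𝔤, ∀ v w, ψ₁.form (Y v) w + ψ₁.form v (Y w) = 0 := by
    intro Y hY v w
    obtain ⟨X, hX, rfl⟩ := h𝔤mem.1 hY
    exact hc₁skew X hX v w
  have hspanC𝔤 : spanC 𝔤 = Submodule.span ℂ
      ((fun X : Module.End ℚ U => (π₁ ∘ₗ X ∘ₗ ι₁).baseChange ℂ) '' (𝔞 : Set _)) := by
    rw [spanC, h𝔤, Submodule.map_coe, Set.image_image]
    simp only [hcLin]
  -- `Θ₁ = c₁(Θ_U) ∈ 𝔤_ℂ`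
  have hcorner : ∀ T ∈ spanC 𝔞, π₁.baseChange ℂ ∘ₗ T ∘ₗ ι₁.baseChange ℂ ∈ spanC 𝔤 := by
    intro T hT
    induction hT using Submodule.span_induction with
    | mem Z hZ =>
      obtain ⟨X, hX, rfl⟩ := hZ
      rw [← LinearMap.baseChange_comp, ← LinearMap.baseChange_comp]
      exact baseChange_mem_spanC (h𝔤mem.2 ⟨X, hX, rfl⟩)
    | zero => rw [LinearMap.zero_comp, LinearMap.comp_zero]; exact Submodule.zero_mem _
    | add Z Z' _ _ hZ hZ' => rw [LinearMap.add_comp, LinearMap.comp_add]; exact Submodule.add_mem _ hZ hZ'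
    | smul c Z _ hZ => rw [LinearMap.smul_comp, LinearMap.comp_smul]; exact Submodule.smul_mem _ c hZ
  have hΘ₁𝔤 : Θ₁ ∈ spanC 𝔤 := by
    have h : Θ₁ = π₁.baseChange ℂ ∘ₗ ΘU ∘ₗ ι₁.baseChange ℂ := by
      apply LinearMap.ext
      intro x
      rw [LinearMap.comp_apply, LinearMap.comp_apply, hΘι₁, proj_incl_baseChange hπι₁]
    rw [h]
    exact hcorner ΘU hΘ𝔞
  -- brackets of elements of `𝔤_ℂ`, placed on `V₁`, lie in `𝔞_ℂ`
  have hD : ∀ Y ∈ spanC 𝔤, ∀ Y' ∈ spanC 𝔤,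
      ι₁.baseChange ℂ ∘ₗ (Y * Y' - Y' * Y) ∘ₗ π₁.baseChange ℂ ∈ spanC 𝔞 := by
    intro Y hY Y' hY'
    rw [hspanC𝔤] at hY hY'
    exact incl_bracket_proj_mem_spanC 𝔞 hbr𝔞 hY hY'
  -- Deligne reductivity `𝔤 = 𝔷(𝔤) ⊕ 𝔡(𝔤)`, `𝔷(𝔤) ⊆ 𝔷₁` (Z1), `Θ₁ = z + s`
  set 𝔷 : Submodule ℚ (Module.End ℚ V₁) :=
    𝔤 ⊓ Subalgebra.toSubmodule (Subalgebra.centralizer ℚ (𝔤 : Set (Module.End ℚ V₁))) with h𝔷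
  set 𝔡 : Submodule ℚ (Module.End ℚ V₁) := Submodule.span ℚ {B | ∃ X ∈ 𝔤, ∃ Y ∈ 𝔤, X * Y - Y * X = B} with h𝔡
  have h𝔷mem : ∀ {Z}, Z ∈ 𝔷 ↔ Z ∈ 𝔤 ∧ ∀ Y ∈ 𝔤, Z * Y = Y * Z := fun {Z} =>
    Literature.Algebra.Lie.TraceSeparating.mem_center_iff 𝔤 Z
  have hdec : 𝔷 ⊔ 𝔡 = 𝔤 := ThetaSubalgebra.center_sup_derived_eq H₁ hn heff₁ ψ₁ 𝔤 hbr𝔤 hΘ₁ hΘ₁𝔤 hskew𝔤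
  have h𝔷le : spanC 𝔷 ≤ spanC 𝔷₁ := by
    refine spanC_mono fun Z hZ => ?_
    obtain ⟨hZ𝔤, hZc⟩ := h𝔷mem.1 hZ
    obtain ⟨hZE, hZcE⟩ := mem_endAlg_and_commute_of_mem_center H₁ 𝔤 hΘ₁ hΘ₁𝔤 hcomm𝔤 hZ𝔤 hZc
    exact hZ₁ Z hZE hZcE (hskew𝔤 Z hZ𝔤)
  have hΘ' : Θ₁ ∈ spanC 𝔷 ⊔ spanC 𝔡 := by rw [← spanC_sup, hdec]; exact hΘ₁𝔤
  obtain ⟨z, hz, s, hs, hzs⟩ := Submodule.mem_sup.1 hΘ'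
  have hz₁ : z ∈ spanC 𝔷₁ := h𝔷le hz
  -- `ι₁ s π₁ ∈ 𝔞_ℂ` (Goursat)
  have hsmem : ι₁.baseChange ℂ ∘ₗ s ∘ₗ π₁.baseChange ℂ ∈ spanC 𝔞 :=
    incl_comp_proj_mem_spanC_of_mem_span_commutators 𝔞 hD (mem_span_commutators_baseChange_of_mem_spanC_derived hs)
  -- `Θ₂ ∈ 𝔲_ℂ` (COMM)
  have hΘ₂𝔲 : Θ₂ ∈ spanC 𝔲 :=
    hcommC Θ₂ (fun i => commute_baseChange_of_mem_hodgeLieC H₂ hΘ₂C ⟨fam i, hfamE i⟩)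
      (fun x y => by rw [formBaseChange_skew_of_mem_hodgeLieC ψ₂ hΘ₂C, neg_add_cancel])
  -- goal: `ι₁ Θ₁ π₁ ∈ 𝔞_ℂ`
  suffices hgoal : ι₁.baseChange ℂ ∘ₗ Θ₁ ∘ₗ π₁.baseChange ℂ ∈ spanC 𝔞 from
    wordDerAt_eq_zero_of_mem_spanC_annLie φ eQ aF q hgoal u
  have hΘ₁eq : ι₁.baseChange ℂ ∘ₗ Θ₁ ∘ₗ π₁.baseChange ℂ = ΘU - ι₂.baseChange ℂ ∘ₗ Θ₂ ∘ₗ π₂.baseChange ℂ := by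
    rw [hΘUdec, add_sub_cancel_right]
  -- the linear placements `J₁ x = ι₁ x π₁`, `J₂ y = ι₂ y π₂` and the rational space `W = J₁ 𝔷₁ + J₂ 𝔲`
  obtain ⟨J₁, hJ₁⟩ : ∃ L : Module.End ℚ V₁ →ₗ[ℚ] Module.End ℚ U, ∀ x, L x = ι₁ ∘ₗ x ∘ₗ π₁ :=
    ⟨{ toFun := fun x => ι₁ ∘ₗ x ∘ₗ π₁
       map_add' := fun x x' => by rw [LinearMap.add_comp, LinearMap.comp_add]
       map_smul' := fun c x => by rw [LinearMap.smul_comp, LinearMap.comp_smul, RingHom.id_apply] },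
      fun x => rfl⟩
  obtain ⟨J₂, hJ₂⟩ : ∃ L : Module.End ℚ V₂ →ₗ[ℚ] Module.End ℚ U, ∀ y, L y = ι₂ ∘ₗ y ∘ₗ π₂ :=
    ⟨{ toFun := fun y => ι₂ ∘ₗ y ∘ₗ π₂
       map_add' := fun y y' => by rw [LinearMap.add_comp, LinearMap.comp_add]
       map_smul' := fun c y => by rw [LinearMap.smul_comp, LinearMap.comp_smul, RingHom.id_apply] },
      fun y => rfl⟩
  set W : Submodule ℚ (Module.End ℚ U) := 𝔷₁.map J₁ ⊔ 𝔲.map J₂ with hW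
  have hJ₁W : ∀ x ∈ 𝔷₁, ι₁ ∘ₗ x ∘ₗ π₁ ∈ W := fun x hx => by
    rw [← hJ₁]; exact Submodule.mem_sup_left (Submodule.mem_map_of_mem hx)
  have hJ₂W : ∀ y ∈ 𝔲, ι₂ ∘ₗ y ∘ₗ π₂ ∈ W := fun y hy => by
    rw [← hJ₂]; exact Submodule.mem_sup_right (Submodule.mem_map_of_mem hy)
  -- `T = ι₁ z π₁ + ι₂ Θ₂ π₂ = Θ_U - ι₁ s π₁ ∈ (𝔞 ∩ W)_ℂ` (base change commutes with intersections)
  set T : Module.End ℂ (ℂ ⊗[ℚ] U) :=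
    ι₁.baseChange ℂ ∘ₗ z ∘ₗ π₁.baseChange ℂ + ι₂.baseChange ℂ ∘ₗ Θ₂ ∘ₗ π₂.baseChange ℂ with hTdef
  have hTeq : T = ΘU - ι₁.baseChange ℂ ∘ₗ s ∘ₗ π₁.baseChange ℂ := by
    rw [hΘUdec, ← hzs, hTdef]
    simp only [LinearMap.comp_add, LinearMap.add_comp]
    abel
  have hT𝔞 : T ∈ spanC 𝔞 := by
    rw [hTeq]
    exact Submodule.sub_mem _ hΘ𝔞 hsmem
  have hTW : T ∈ spanC W :=
    Submodule.add_mem _ (incl_comp_proj_mem_spanC_of_forall_mem hJ₁W hz₁)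
      (incl_comp_proj_mem_spanC_of_forall_mem hJ₂W hΘ₂𝔲)
  have hT𝔠 : T ∈ spanC (𝔞 ⊓ W) := by
    rw [spanC_inf]
    exact ⟨hT𝔞, hTW⟩
  -- CLAIM: `W ≤ 𝔞` (otherwise a rational functional separating `𝔞 ∩ W` from `W` contradicts (NA))
  have hW𝔞 : W ≤ 𝔞 := by
    by_contra hnot
    obtain ⟨w₀, hw₀W, hw₀𝔞⟩ := Set.not_subset.1 hnot
    have hw₀ : w₀ ∉ 𝔞 ⊓ W := fun h => hw₀𝔞 h.1
    haveI : Module.Free ℚ (Module.End ℚ U ⧸ (𝔞 ⊓ W)) := Module.Free.of_divisionRing ℚ _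
    obtain ⟨f, hfw₀, hf0⟩ := Submodule.exists_dual_map_eq_bot_of_notMem hw₀ inferInstance
    have hf𝔠 : ∀ X ∈ 𝔞 ⊓ W, f X = 0 := fun X hX => by
      have h : f X ∈ (𝔞 ⊓ W).map f := Submodule.mem_map_of_mem hX
      rw [hf0, Submodule.mem_bot] at h
      exact h
    -- complexify `f`
    obtain ⟨g, hg⟩ := exists_functionalC f
    have hgT : g T = 0 :=
      functionalC_eq_zero_of_mem_spanC g (fun X hX => by rw [hg, hf𝔠 X hX, Rat.cast_zero]) hT𝔠
    -- trace representatives of `f ∘ J₁` on `𝔷₁` and of `f ∘ J₂` on `𝔲`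
    obtain ⟨a, ha𝔷₁', ha⟩ := hND₁ (f ∘ₗ J₁)
    obtain ⟨b, hb𝔲', hb⟩ := hND₂ (f ∘ₗ J₂)
    have hg₁ : ∀ Z ∈ spanC 𝔷₁, g (ι₁.baseChange ℂ ∘ₗ Z ∘ₗ π₁.baseChange ℂ) =
        LinearMap.trace ℂ _ (a.baseChange ℂ * Z) := by
      intro Z hZ
      induction hZ using Submodule.span_induction with
      | mem Z hZ =>
        obtain ⟨x, hx, rfl⟩ := hZ
        rw [← LinearMap.baseChange_comp, ← LinearMap.baseChange_comp, hg, ← hJ₁,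
          show f (J₁ x) = (f ∘ₗ J₁) x from rfl, ha x hx, ← LinearMap.baseChange_mul, LinearMap.trace_baseChange,
          eq_ratCast]
      | zero => rw [LinearMap.zero_comp, LinearMap.comp_zero, map_zero, mul_zero, map_zero]
      | add Z Z' _ _ hZ hZ' =>
        rw [LinearMap.add_comp, LinearMap.comp_add, map_add, hZ, hZ', mul_add, map_add]
      | smul c Z _ hZ =>
        rw [LinearMap.smul_comp, LinearMap.comp_smul, map_smul, hZ, mul_smul_comm, map_smul]
    have hg₂ : ∀ Z ∈ spanC 𝔲, g (ι₂.baseChange ℂ ∘ₗ Z ∘ₗ π₂.baseChange ℂ) =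
        LinearMap.trace ℂ _ (b.baseChange ℂ * Z) := by
      intro Z hZ
      induction hZ using Submodule.span_induction with
      | mem Z hZ =>
        obtain ⟨y, hy, rfl⟩ := hZ
        rw [← LinearMap.baseChange_comp, ← LinearMap.baseChange_comp, hg, ← hJ₂,
          show f (J₂ y) = (f ∘ₗ J₂) y from rfl, hb y hy, ← LinearMap.baseChange_mul, LinearMap.trace_baseChange,
          eq_ratCast]
      | zero => rw [LinearMap.zero_comp, LinearMap.comp_zero, map_zero, mul_zero, map_zero]
      | add Z Z' _ _ hZ hZ' =>
        rw [LinearMap.add_comp, LinearMap.comp_add, map_add, hZ, hZ', mul_add, map_add]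
      | smul c Z _ hZ =>
        rw [LinearMap.smul_comp, LinearMap.comp_smul, map_smul, hZ, mul_smul_comm, map_smul]
    -- `Tr(a_ℂ s) = 0`: `a ∈ 𝔷₁' ⊆ End_Hdg(V₁)` commutes with `𝔤`
    have has : LinearMap.trace ℂ _ (a.baseChange ℂ * s) = 0 :=
      trace_mul_eq_zero_of_mem_span_commutators (fun X hX => hcomm𝔤 X hX ⟨a, h𝔷₁'E a ha𝔷₁'⟩)
        (mem_span_commutators_baseChange_of_mem_spanC_derived hs)
    -- the premise of (NA)
    have hsum0 : LinearMap.trace ℂ _ (a.baseChange ℂ * Θ₁) + LinearMap.trace ℂ _ (b.baseChange ℂ * Θ₂) = 0 := by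
      have h1 : LinearMap.trace ℂ _ (a.baseChange ℂ * Θ₁) = LinearMap.trace ℂ _ (a.baseChange ℂ * z) := by
        rw [← hzs, mul_add, map_add, has, add_zero]
      rw [h1, ← hg₁ z hz₁, ← hg₂ Θ₂ hΘ₂𝔲, ← map_add]
      exact hgT
    obtain ⟨hA, hB⟩ := hNA a ha𝔷₁' b hb𝔲' hsum0
    -- `f` vanishes on `W`
    have hfW : ∀ X ∈ W, f X = 0 := by
      intro X hX
      obtain ⟨X₁, hX₁, X₂, hX₂, rfl⟩ := Submodule.mem_sup.1 hX
      obtain ⟨x, hx, rfl⟩ := Submodule.mem_map.1 hX₁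
      obtain ⟨y, hy, rfl⟩ := Submodule.mem_map.1 hX₂
      rw [map_add, show f (J₁ x) = (f ∘ₗ J₁) x from rfl, ha x hx, hA x hx,
        show f (J₂ y) = (f ∘ₗ J₂) y from rfl, hb y hy, hB y hy, add_zero]
    exact hfw₀ (hfW w₀ hw₀W)
  -- conclusion: `ι₂ Θ₂ π₂ ∈ 𝔞_ℂ`, hence `ι₁ Θ₁ π₁ = Θ_U - ι₂ Θ₂ π₂ ∈ 𝔞_ℂ`
  rw [hΘ₁eq]
  exact Submodule.sub_mem _ hΘ𝔞
    (incl_comp_proj_mem_spanC_of_forall_mem (fun y hy => hW𝔞 (hJ₂W y hy)) hΘ₂𝔲)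

end Main

end HodgeStructure

end Literature.AlgebraicGeometry.Motives

end
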